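import Summits.CriticalPhenomena.PercolationContinuityZ3.Theorems.PercNearOneGluingNoHeavyLowerTailStarSetLinkGluing
import Summits.CriticalPhenomena.PercolationContinuityZ3.Theorems.PercNearOneGluingNoHeavyLowerTailCILSetStarTools
import Literature.Probability.LatticeModels.ProdBernoulliClusterLocality
import Literature.Probability.LatticeModels.ProdBernoulliIndependence
import HarnessLib

/-!
# `NoHeavyLowerTail` (stmt-CriticalPhenomena-4575) — the LINK REPRESENTATION of a family of two-port stars

Support file (prover `prim-gen-swap` gen 7; `--supports stmt-CriticalPhenomena-4575`).  No definitions, no named facts, no sorries.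

Setting of the level-two observer-set theorem for two-port star sets (seat memo R3-SEATS.md §7, blueprint
`setCS_twoPortStars_levelTwo`): `m` star centres `s i` (pairwise distinct) with ports `p i ≠ p' i` (never a star centre);
under the weights `W` the only positive pairs at `s i` are `s(s i, p i)` and `s(s i, p' i)`.  Write `ξ(ω) = ω ∩ {e | no star centre in e}`
for the configuration off the stars and, for a pattern `σ ⊆ Fin m`, `L_σ = {s(p i, p' i) : i ∈ σ}` for the LINKS of the stars in `σ`.

* `StarSet.reachable_iff_links` (pointwise) — if the pairs at the star centres open in `ω` are port pairs only, and `σ` is the set of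
  stars with BOTH port pairs open, then two vertices off the stars are joined in `ω` iff they are joined in `ξ(ω) ∪ L_σ`.
* `StarSet.measureReal_eq_sum_fiber` — partition of an event by the value of a finitely-valued map.
* `StarSet.real_reachFunctional_eq_linkSum` — **link representation**: for every functional `Ψ` of the reachability relation that
  only reads pairs of vertices off the stars,
  `μ_W{Ψ(Reach_ω)} = Σ_σ (Π_{i∈σ} θ_i)(Π_{i∉σ} (1 − θ_i)) · μ_w{Ψ(Reach_{ξ(ω) ∪ L_σ})}`,  `θ_i = W(s(s i,p i))·W(s(s i,p' i))`,
  for any `w` agreeing with `W` off the stars (independence of the star pairs from `ξ`, the product formula for the pattern class,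
  and `prodBernoulli_real_eq_of_determinedBy`).
* `StarSet.real_reachFunctional_eq_of_sameLinks` — two such weight functions with the same link probabilities `θ_i` give the same
  probability to every such functional (e.g. the relay lightness `μ{|π(x)| ≤ j}` of a vertex off the stars).
These are steps (2)–(4)'s integration device in the proof of `setCS_twoPortStars_levelTwo`: rows and champion rows of the GLUED graph
(star `i` surely attached to `p i`, second pair of weight `θ_i`) are the pattern averages of the corresponding `ξ ∪ L_σ` events.
-/

noncomputable section

namespace Summit.CriticalPhenomena.PercolationContinuityZ3.Theorems

open MeasureTheory Set Literature.Probability.LatticeModels Literature.Probability.Percolation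
open scoped Classical BigOperators

variable {n m : ℕ}

namespace StarSet

/-- **Star paths are links (pointwise).**  If every pair open at a star centre `s i` is one of its two port pairs, and `σ` is the
set of stars with both port pairs open, then for `a, b` off the stars: `a ↔ b` in `ω` iff `a ↔ b` in `ξ(ω) ∪ L_σ`. [folklore] -/
theorem reachable_iff_links (ω : BondConfig (Fin n)) (s p p' : Fin m → Fin n) (σ : Finset (Fin m))
    (hps : ∀ i k, p i ≠ s k) (hp's : ∀ i k, p' i ≠ s k) (hpp' : ∀ i, p i ≠ p' i)
    (hjunk : ∀ i u, u ≠ s i → s(s i, u) ∈ ω → u = p i ∨ u = p' i)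
    (hσ : ∀ i, i ∈ σ ↔ (s(s i, p i) ∈ ω ∧ s(s i, p' i) ∈ ω))
    {a b : Fin n} (ha : ∀ i, a ≠ s i) (hb : ∀ i, b ≠ s i) :
    (openGraph ω).Reachable a b ↔
      (openGraph ((ω ∩ {e | ∀ v ∈ Finset.univ.image s, v ∉ e}) ∪
        ↑(σ.image fun i => (s(p i, p' i) : Sym2 (Fin n))))).Reachable a b := by
  set G' := openGraph ((ω ∩ {e | ∀ v ∈ Finset.univ.image s, v ∉ e}) ∪
    ↑(σ.image fun i => (s(p i, p' i) : Sym2 (Fin n)))) with hG'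
  constructor
  · intro h
    have key := reachable_of_adjClosed (openGraph ω)
      {v | ((∀ i, v ≠ s i) ∧ G'.Reachable a v) ∨
        ∃ i, v = s i ∧ ((s(s i, p i) ∈ ω ∧ G'.Reachable a (p i)) ∨ (s(s i, p' i) ∈ ω ∧ G'.Reachable a (p' i)))}
      (x := a) (Or.inl ⟨ha, SimpleGraph.Reachable.refl a⟩) ?_ h
    · rcases key with ⟨-, hk⟩ | ⟨i, hbi, -⟩
      · exact hk
      · exact absurd hbi (hb i)
    intro u v hu huv
    rw [openGraph_adj] at huv
    obtain ⟨huv, hne⟩ := huv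
    rcases hu with ⟨huB, hau⟩ | ⟨i, rfl, hi⟩
    · by_cases hvB : ∀ i, v ≠ s i
      · left
        refine ⟨hvB, hau.trans ?_⟩
        have hadj : G'.Adj u v := by
          rw [hG', openGraph_adj]
          refine ⟨mem_union_left _ ⟨huv, ?_⟩, hne⟩
          intro x hx hxe
          rw [Finset.mem_image] at hx
          obtain ⟨i, -, rfl⟩ := hx
          rcases Sym2.mem_iff.1 hxe with h' | h'
          · exact huB i h'.symm
          · exact hvB i h'.symm
        exact hadj.reachable
      · push Not at hvB
        obtain ⟨i, rfl⟩ := hvB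
        right
        refine ⟨i, rfl, ?_⟩
        have huv' : s(s i, u) ∈ ω := by rw [Sym2.eq_swap]; exact huv
        rcases hjunk i u hne huv' with rfl | rfl
        · exact Or.inl ⟨huv', hau⟩
        · exact Or.inr ⟨huv', hau⟩
    · have hv := hjunk i v hne.symm huv
      left
      rcases hv with rfl | rfl
      · refine ⟨fun k => hps i k, ?_⟩
        rcases hi with ⟨-, h⟩ | ⟨h2, h⟩
        · exact h
        · have hiσ : i ∈ σ := (hσ i).2 ⟨huv, h2⟩
          have hadj : G'.Adj (p' i) (p i) := by
            rw [hG', openGraph_adj]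
            refine ⟨mem_union_right _ ?_, (hpp' i).symm⟩
            rw [Finset.mem_coe, Finset.mem_image]
            exact ⟨i, hiσ, Sym2.eq_swap⟩
          exact h.trans hadj.reachable
      · refine ⟨fun k => hp's i k, ?_⟩
        rcases hi with ⟨h1, h⟩ | ⟨-, h⟩
        · have hiσ : i ∈ σ := (hσ i).2 ⟨h1, huv⟩
          have hadj : G'.Adj (p i) (p' i) := by
            rw [hG', openGraph_adj]
            refine ⟨mem_union_right _ ?_, hpp' i⟩
            rw [Finset.mem_coe, Finset.mem_image]
            exact ⟨i, hiσ, rfl⟩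
          exact h.trans hadj.reachable
        · exact h
  · intro h
    refine reachable_of_adjClosed G' {v | (openGraph ω).Reachable a v} (x := a) (SimpleGraph.Reachable.refl a) ?_ h
    intro u v hu huv
    rw [hG', openGraph_adj, mem_union] at huv
    obtain ⟨huv, hne⟩ := huv
    rcases huv with hξ | hL
    · exact hu.trans (((openGraph_adj ω u v).2 ⟨hξ.1, hne⟩).reachable)
    · rw [Finset.mem_coe, Finset.mem_image] at hL
      obtain ⟨i, hiσ, hi⟩ := hL
      obtain ⟨h1, h2⟩ := (hσ i).1 hiσ
      have hpath : (openGraph ω).Reachable (p i) (p' i) := by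
        have a1 : (openGraph ω).Adj (p i) (s i) := by
          rw [openGraph_adj, Sym2.eq_swap]; exact ⟨h1, hps i i⟩
        have a2 : (openGraph ω).Adj (s i) (p' i) := by
          rw [openGraph_adj]; exact ⟨h2, (hp's i i).symm⟩
        exact a1.reachable.trans a2.reachable
      rcases Sym2.eq_iff.1 hi with ⟨hu', hv'⟩ | ⟨hv', hu'⟩
      · rw [← hv']
        rw [← hu'] at hu
        exact hu.trans hpath
      · rw [← hv']
        rw [← hu'] at hu
        exact hu.trans hpath.symm

/-- Partition of an event by the value of a map with values in a finite family. [folklore] -/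
theorem measureReal_eq_sum_fiber (μ : Measure (BondConfig (Fin n))) [IsFiniteMeasure μ] {κ : Type*}
    (τ : BondConfig (Fin n) → κ) (𝒴 : Finset κ) (h𝒴 : ∀ ω, τ ω ∈ 𝒴) (E : Set (BondConfig (Fin n))) :
    μ.real E = ∑ y ∈ 𝒴, μ.real (E ∩ {ω | τ ω = y}) := by
  have hdisj : (↑𝒴 : Set κ).PairwiseDisjoint fun y => E ∩ {ω | τ ω = y} := by
    intro y _ y' _ hne
    rw [Function.onFun, Set.disjoint_left]
    rintro ω ⟨-, hy⟩ ⟨-, hy'⟩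
    exact hne (hy.symm.trans hy')
  have hunion : (⋃ y ∈ 𝒴, (E ∩ {ω | τ ω = y})) = E := by
    ext ω
    simp only [mem_iUnion, mem_inter_iff, mem_setOf_eq, exists_prop]
    exact ⟨fun ⟨_, _, hE, _⟩ => hE, fun hE => ⟨τ ω, h𝒴 ω, hE, rfl⟩⟩
  rw [← measureReal_biUnion_finset hdisj fun y _ => MeasurableSet.of_discrete, hunion]

/-- **Link representation.**  Stars `s i` (pairwise distinct) with ports `p i ≠ p' i` off the stars; under `W` the only positive pairs
at `s i` are its two port pairs; `w` agrees with `W` off the stars; `Ψ` reads the reachability relation between vertices off the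
stars only.  Then `μ_W{Ψ(Reach_ω)} = Σ_σ (Π_{i∈σ} θ_i)(Π_{i∉σ}(1 − θ_i)) · μ_w{Ψ(Reach_{ξ(ω) ∪ L_σ})}` with
`θ_i = W(s(s i,p i))·W(s(s i,p' i))`. [folklore] -/
theorem real_reachFunctional_eq_linkSum (W w : Sym2 (Fin n) → unitInterval) (s p p' : Fin m → Fin n)
    (hs : Function.Injective s) (hps : ∀ i k, p i ≠ s k) (hp's : ∀ i k, p' i ≠ s k) (hpp' : ∀ i, p i ≠ p' i)
    (hWjunk : ∀ i u, u ≠ s i → u ≠ p i → u ≠ p' i → W s(s i, u) = 0)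
    (hWoff : ∀ e : Sym2 (Fin n), (∀ i, s i ∉ e) → W e = w e)
    (Ψ : (Fin n → Fin n → Prop) → Prop)
    (hΨ : ∀ R R' : Fin n → Fin n → Prop,
      (∀ a b, (∀ i, a ≠ s i) → (∀ i, b ≠ s i) → (R a b ↔ R' a b)) → (Ψ R ↔ Ψ R')) :
    (prodBernoulli W).real {ω : BondConfig (Fin n) | Ψ fun a b => (openGraph ω).Reachable a b} =
      ∑ σ ∈ (Finset.univ : Finset (Fin m)).powerset,
        ((∏ i ∈ σ, ((W s(s i, p i) : ℝ) * W s(s i, p' i))) *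
            ∏ i ∈ Finset.univ \ σ, (1 - (W s(s i, p i) : ℝ) * W s(s i, p' i))) *
          (prodBernoulli w).real {ω : BondConfig (Fin n) | Ψ fun a b =>
            (openGraph ((ω ∩ {e | ∀ v ∈ Finset.univ.image s, v ∉ e}) ∪
              ↑(σ.image fun i => (s(p i, p' i) : Sym2 (Fin n))))).Reachable a b} := by
  haveI : ∀ u : Sym2 (Fin n) → unitInterval, IsProbabilityMeasure (prodBernoulli u) := fun u => inferInstance
  set μ := prodBernoulli W with hμ
  -- the junk pairs at the stars and their null event
  set J : Finset (Sym2 (Fin n)) :=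
    (((Finset.univ : Finset (Fin m)) ×ˢ (Finset.univ : Finset (Fin n))).filter
      fun q => q.2 ≠ s q.1 ∧ q.2 ≠ p q.1 ∧ q.2 ≠ p' q.1).image fun q => s(s q.1, q.2) with hJ
  set N : Set (BondConfig (Fin n)) := {ω | ∃ e ∈ J, e ∈ ω} with hN
  have hN0 : μ N = 0 := by
    have hle : μ.real N ≤ 0 := by
      refine le_trans (prodBernoulli_real_exists_mem_le_sum W J) (le_of_eq (Finset.sum_eq_zero fun e he => ?_))
      rw [hJ, Finset.mem_image] at he
      obtain ⟨q, hq, rfl⟩ := he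
      rw [Finset.mem_filter] at hq
      rw [hWjunk q.1 q.2 hq.2.1 hq.2.2.1 hq.2.2.2]
      rfl
    have h0 : μ.real N = 0 := le_antisymm hle measureReal_nonneg
    exact (measureReal_eq_zero_iff (measure_ne_top _ _)).1 h0
  have hjunk : ∀ ω : BondConfig (Fin n), ω ∉ N → ∀ i u, u ≠ s i → s(s i, u) ∈ ω → u = p i ∨ u = p' i := by
    intro ω hω i u hu he
    by_contra hc
    push Not at hc
    refine hω ⟨s(s i, u), ?_, he⟩
    rw [hJ, Finset.mem_image]
    exact ⟨(i, u), Finset.mem_filter.2 ⟨Finset.mem_product.2 ⟨Finset.mem_univ _, Finset.mem_univ _⟩, hu, hc.1, hc.2⟩, rfl⟩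
  -- the pattern of stars with both port pairs open
  set τ : BondConfig (Fin n) → Finset (Fin m) :=
    fun ω => Finset.univ.filter fun i => s(s i, p i) ∈ ω ∧ s(s i, p' i) ∈ ω with hτ
  set E := {ω : BondConfig (Fin n) | Ψ fun a b => (openGraph ω).Reachable a b} with hE
  set B : Finset (Fin m) → Set (BondConfig (Fin n)) := fun σ => {ω | Ψ fun a b =>
    (openGraph ((ω ∩ {e | ∀ v ∈ Finset.univ.image s, v ∉ e}) ∪
      ↑(σ.image fun i => (s(p i, p' i) : Sym2 (Fin n))))).Reachable a b} with hB
  set E' := {ω : BondConfig (Fin n) | ω ∈ B (τ ω)} with hE'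
  -- (1) `E = E'` off the null set `N`
  have hEE' : μ.real E = μ.real E' := by
    apply measureReal_congr
    refine ae_eq_set.2 ⟨measure_mono_null (fun ω hω => ?_) hN0, measure_mono_null (fun ω hω => ?_) hN0⟩
    · by_contra hZ
      refine hω.2 ?_
      have hiff := hΨ _ _ (fun a b ha' hb' => reachable_iff_links ω s p p' (τ ω) hps hp's hpp' (hjunk ω hZ)
        (fun i => by rw [hτ, Finset.mem_filter]; exact ⟨fun h => h.2, fun h => ⟨Finset.mem_univ _, h⟩⟩) ha' hb')
      exact hiff.1 hω.1
    · by_contra hZ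
      refine hω.2 ?_
      have hiff := hΨ _ _ (fun a b ha' hb' => reachable_iff_links ω s p p' (τ ω) hps hp's hpp' (hjunk ω hZ)
        (fun i => by rw [hτ, Finset.mem_filter]; exact ⟨fun h => h.2, fun h => ⟨Finset.mem_univ _, h⟩⟩) ha' hb')
      exact hiff.2 hω.1
  rw [hEE', measureReal_eq_sum_fiber μ τ (Finset.univ : Finset (Fin m)).powerset
    (fun ω => Finset.mem_powerset.2 (Finset.subset_univ _)) E']
  refine Finset.sum_congr rfl fun σ _ => ?_
  -- (2) on the class `{τ = σ}` the event `E'` is `B σ`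
  have hclass : E' ∩ {ω | τ ω = σ} = {ω | τ ω = σ} ∩ B σ := by
    ext ω
    simp only [hE', mem_inter_iff, mem_setOf_eq]
    constructor
    · rintro ⟨h1, h2⟩; exact ⟨h2, h2 ▸ h1⟩
    · rintro ⟨h2, h1⟩; exact ⟨h2.symm ▸ h1, h2⟩
  rw [hclass]
  -- (3) independence of the pattern class from the configuration off the stars
  set PE : Finset (Sym2 (Fin n)) :=
    (Finset.univ.image fun i => (s(s i, p i) : Sym2 (Fin n))) ∪
      Finset.univ.image fun i => (s(s i, p' i) : Sym2 (Fin n)) with hPE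
  set Foff : Finset (Sym2 (Fin n)) := Finset.univ.filter fun e : Sym2 (Fin n) => ∀ v ∈ Finset.univ.image s, v ∉ e
    with hFoff
  have hdisjF : Disjoint PE Foff := by
    rw [Finset.disjoint_left]
    intro e he he'
    rw [hFoff, Finset.mem_filter] at he'
    rw [hPE, Finset.mem_union, Finset.mem_image, Finset.mem_image] at he
    rcases he with ⟨i, -, rfl⟩ | ⟨i, -, rfl⟩
    · exact he'.2 (s i) (Finset.mem_image_of_mem s (Finset.mem_univ i)) (Sym2.mem_mk_left _ _)
    · exact he'.2 (s i) (Finset.mem_image_of_mem s (Finset.mem_univ i)) (Sym2.mem_mk_left _ _)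
  have hdetA : DeterminedBy {ω : BondConfig (Fin n) | τ ω = σ} (↑PE : Set (Sym2 (Fin n))) := by
    rw [determinedBy_iff]
    intro ω ω' hωω'
    have key : ∀ e ∈ PE, (e ∈ ω ↔ e ∈ ω') := by
      intro e he
      have := Set.ext_iff.1 hωω' e
      simp only [mem_inter_iff, Finset.mem_coe, he, and_true] at this
      exact this
    have hτeq : τ ω = τ ω' := by
      simp only [hτ]
      refine Finset.filter_congr fun i _ => ?_
      rw [key _ (Finset.mem_union_left _ (Finset.mem_image_of_mem _ (Finset.mem_univ i))),
        key _ (Finset.mem_union_right _ (Finset.mem_image_of_mem _ (Finset.mem_univ i)))]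
    simp only [mem_setOf_eq, hτeq]
  have hdetB : DeterminedBy (B σ) (↑Foff : Set (Sym2 (Fin n))) :=
    CutObserver.SetStar.determinedBy_off (Finset.univ.image s) (fun ξ => Ψ fun a b =>
      (openGraph (ξ ∪ ↑(σ.image fun i => (s(p i, p' i) : Sym2 (Fin n))))).Reachable a b)
  rw [prodBernoulli_real_inter_of_determinedBy_disjoint W hdisjF hdetA hdetB MeasurableSet.of_discrete
    MeasurableSet.of_discrete]
  -- (4) the configuration off the stars has the same law under `W` and `w`
  have hoff : μ.real (B σ) = (prodBernoulli w).real (B σ) := by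
    refine prodBernoulli_real_eq_of_determinedBy W w (F := (↑Foff : Set (Sym2 (Fin n)))) (fun e he => ?_) hdetB
      MeasurableSet.of_discrete
    rw [Finset.mem_coe, hFoff, Finset.mem_filter] at he
    exact hWoff e fun i hi => he.2 (s i) (Finset.mem_image_of_mem s (Finset.mem_univ i)) hi
  rw [hoff]
  congr 1
  -- (5) the product formula for the pattern class
  set C : Fin m → Set (BondConfig (Fin n)) :=
    fun i => {ω | (s(s i, p i) ∈ ω ∧ s(s i, p' i) ∈ ω) ↔ i ∈ σ} with hC
  have hclassC : {ω : BondConfig (Fin n) | τ ω = σ} = Set.univ ∩ ⋂ i ∈ (Finset.univ : Finset (Fin m)), C i := by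
    ext ω
    simp only [hτ, hC, mem_inter_iff, mem_univ, true_and, mem_iInter, mem_setOf_eq, Finset.mem_univ, forall_true_left]
    constructor
    · intro h i
      rw [← h, Finset.mem_filter]
      exact ⟨fun hh => ⟨Finset.mem_univ _, hh⟩, fun hh => hh.2⟩
    · intro h
      ext i
      rw [Finset.mem_filter]
      exact ⟨fun hh => (h i).1 hh.2, fun hh => ⟨Finset.mem_univ _, (h i).2 hh⟩⟩
  have hne : ∀ i, (s(s i, p i) : Sym2 (Fin n)) ≠ s(s i, p' i) := fun i h => hpp' i (Sym2.congr_right.1 h)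
  have hSdisj : (↑(Finset.univ : Finset (Fin m)) : Set (Fin m)).PairwiseDisjoint
      fun i => ({s(s i, p i), s(s i, p' i)} : Finset (Sym2 (Fin n))) := by
    intro i _ k _ hik
    rw [Function.onFun, Finset.disjoint_left]
    intro e hei hek
    simp only [Finset.mem_insert, Finset.mem_singleton] at hei hek
    have hsik : s i ≠ s k := fun h => hik (hs h)
    have aux : ∀ (x y : Fin n), (s(s i, x) : Sym2 (Fin n)) = s(s k, y) → (∀ l, y ≠ s l) → False := by
      intro x y h hy
      rcases Sym2.eq_iff.1 h with ⟨h1, _⟩ | ⟨h1, _⟩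
      · exact hsik h1
      · exact hy i h1.symm
    rcases hei with rfl | rfl <;> rcases hek with h | h
    · exact aux _ _ h (fun l => hps k l)
    · exact aux _ _ h (fun l => hp's k l)
    · exact aux _ _ h (fun l => hps k l)
    · exact aux _ _ h (fun l => hp's k l)
  have hCdet : ∀ i ∈ (Finset.univ : Finset (Fin m)),
      DeterminedBy (C i) (↑({s(s i, p i), s(s i, p' i)} : Finset (Sym2 (Fin n))) : Set (Sym2 (Fin n))) := by
    intro i _
    rw [determinedBy_iff]
    intro ω ω' hωω'
    have key : ∀ e ∈ ({s(s i, p i), s(s i, p' i)} : Finset (Sym2 (Fin n))), (e ∈ ω ↔ e ∈ ω') := by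
      intro e he
      have := Set.ext_iff.1 hωω' e
      simp only [mem_inter_iff, Finset.mem_coe, he, and_true] at this
      exact this
    simp only [hC, mem_setOf_eq]
    rw [key _ (by simp), key _ (by simp)]
  have hprod := prodBernoulli_real_inter_biInter_of_determinedBy W (Finset.univ : Finset (Fin m))
    (fun i => ({s(s i, p i), s(s i, p' i)} : Finset (Sym2 (Fin n)))) hSdisj hCdet
    (fun i _ => MeasurableSet.of_discrete) (A := Set.univ) (determinedBy_univ _) MeasurableSet.univ
  rw [hclassC, hprod, probReal_univ, one_mul]
  have hCi : ∀ i, μ.real (C i) =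
      if i ∈ σ then (W s(s i, p i) : ℝ) * W s(s i, p' i) else 1 - (W s(s i, p i) : ℝ) * W s(s i, p' i) := by
    intro i
    have hboth : μ.real {ω : BondConfig (Fin n) | s(s i, p i) ∈ ω ∧ s(s i, p' i) ∈ ω} =
        (W s(s i, p i) : ℝ) * W s(s i, p' i) := by
      have h := prodBernoulli_real_subset W ({s(s i, p i), s(s i, p' i)} : Finset (Sym2 (Fin n)))
      rw [Finset.prod_pair (hne i)] at h
      rw [← h]
      congr 1
      ext ω
      simp only [mem_setOf_eq, Finset.coe_insert, Finset.coe_singleton, Set.insert_subset_iff, Set.singleton_subset_iff]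
    by_cases hi : i ∈ σ
    · rw [if_pos hi, ← hboth]
      congr 1
      ext ω
      simp only [hC, mem_setOf_eq, hi, iff_true]
    · rw [if_neg hi, ← hboth, ← probReal_compl_eq_one_sub MeasurableSet.of_discrete]
      congr 1
      ext ω
      simp only [hC, mem_setOf_eq, hi, iff_false, mem_compl_iff]
  rw [Finset.prod_congr rfl fun i _ => hCi i]
  rw [Finset.prod_ite, Finset.filter_mem_eq_inter, Finset.univ_inter, Finset.filter_not, Finset.filter_mem_eq_inter,
    Finset.univ_inter]

/-- **Same links, same relay-side law.**  Two weight functions as in `real_reachFunctional_eq_linkSum`, agreeing off the stars and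
with the same link probabilities `θ_i`, give the same probability to every functional of the reachability relation between vertices
off the stars (e.g. to the lightness `μ{|π(x)| ≤ j}` of a vertex `x` off the stars w.r.t. relays off the stars). [folklore] -/
theorem real_reachFunctional_eq_of_sameLinks (W W' w : Sym2 (Fin n) → unitInterval) (s p p' : Fin m → Fin n)
    (hs : Function.Injective s) (hps : ∀ i k, p i ≠ s k) (hp's : ∀ i k, p' i ≠ s k) (hpp' : ∀ i, p i ≠ p' i)
    (hWjunk : ∀ i u, u ≠ s i → u ≠ p i → u ≠ p' i → W s(s i, u) = 0)
    (hWoff : ∀ e : Sym2 (Fin n), (∀ i, s i ∉ e) → W e = w e)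
    (hW'junk : ∀ i u, u ≠ s i → u ≠ p i → u ≠ p' i → W' s(s i, u) = 0)
    (hW'off : ∀ e : Sym2 (Fin n), (∀ i, s i ∉ e) → W' e = w e)
    (hθ : ∀ i, (W s(s i, p i) : ℝ) * W s(s i, p' i) = (W' s(s i, p i) : ℝ) * W' s(s i, p' i))
    (Ψ : (Fin n → Fin n → Prop) → Prop)
    (hΨ : ∀ R R' : Fin n → Fin n → Prop,
      (∀ a b, (∀ i, a ≠ s i) → (∀ i, b ≠ s i) → (R a b ↔ R' a b)) → (Ψ R ↔ Ψ R')) :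
    (prodBernoulli W).real {ω : BondConfig (Fin n) | Ψ fun a b => (openGraph ω).Reachable a b} =
      (prodBernoulli W').real {ω : BondConfig (Fin n) | Ψ fun a b => (openGraph ω).Reachable a b} := by
  rw [real_reachFunctional_eq_linkSum W w s p p' hs hps hp's hpp' hWjunk hWoff Ψ hΨ,
    real_reachFunctional_eq_linkSum W' w s p p' hs hps hp's hpp' hW'junk hW'off Ψ hΨ]
  simp only [hθ]

end StarSet

end Summit.CriticalPhenomena.PercolationContinuityZ3.Theorems

end
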